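import Literature.NumberTheory.EllipticCurves.Rank1Residual.Typed.JetchevTamagawaCertificate
import Literature.NumberTheory.EllipticCurves.Rank1Residual.Predicates
import Literature.NumberTheory.EllipticCurves.HeegnerPoints
import HarnessLib

/-!
# Burungale–Skinner–Tian–Wan (arXiv:2409.01350v2, PREPRINT), §11.2.2 Thm. 11.8 (b) for an elliptic
# curve: the OPTIMAL upper bound `#Ш(E/L)[p^∞] · ∏_{q∣N} c_q(E)² ≤_p [E(L) ⊗ ℤ_p : ℤ_p·P_L]²` by the
# index of a Heegner point, `p` ALLOWED to divide the Tamagawa numbers — ONE explicitly labelled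
# OPEN binder (claim-tagged; NEVER a fact) and the per-pair certificate it feeds

Written by the typer seat `bsd-littype-01` (gen 2) of the cross-ladder literature-typing layer
(D-0088(4); cell `run/shared/lean/pub/bsd-littype/`). D-0064: one file for §11.2.2 of the source.
HONEST FRAMING: the source is an UNREFEREED preprint; it enters the tree ONLY as an explicitly
labelled OPEN hypothesis (`def … : Prop`, `[claim: …, status: under-review]`), NEVER as a theorem and
NEVER as a `[cite:]`-fact; nothing is asserted about any curve; nothing is booked; no `_holds`. The
theorems of this file take the binder as an explicit hypothesis `hBSTW_OPEN` and are bookkeeping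
(arithmetic on the inequality + published tree theorems BY NAME), exactly the chain of the tree's
PUBLISHED companion `Rank1Residual/Typed/JetchevTamagawaCertificate.lean` (Jetchev 2008 Cor. 1.5)
with BSTW's sharper bound in place of Jetchev's.

## The printed statement (arXiv:2409.01350v2, p. 92; TeX label `boundSha`, tex l.7847; litref
## page file `pub/bsd-litref/bstw24/staging/bsd-litref-bstw24-ty/text/bstw24-v2-pages.json` p. 92)

> **Theorem 11.8.** Let `g ∈ S₂(Γ₀(N))` be an elliptic newform, `F` the Hecke field and `𝒪` the
> integer ring. Let `A_g` be an associated `GL₂`-type abelian variety over `ℚ` with `𝒪 ↪ End(A_g)`.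
> Let `p ∤ 2N` be a prime and `λ` a prime of the Hecke field `F` above `p`. Suppose that either
> `λ ∤ a_p(g)` or `a_p(g) = 0`. (a) We have `ord_{s=1} L(s,g) = 1 ⟹ #Ш(A_g)[λ^∞] < ∞`.
> (b) Suppose that `ord_{s=1} L(s,g) ≤ 1`. Suppose also that (van_ℚ) and (im) hold for the
> associated `λ`-adic Galois representation. Let `L` be an imaginary quadratic field satisfying
> (ord) [= (2.15): `p` splits in `L`], (coprime) [= (9.9): `(D_L, N) = 1`], (Heeg) [`ℓ ∣ N ⟹ ℓ`
> splits in `L`] and (irr_L) [`T̄` is an absolutely irreducible `k_λ[G_L]`-module] so that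
> `ord_{s=1} L(s, g/L) = 1`. Let `P_L ∈ A_g(L)` be the Heegner point arising from an
> `(𝒪,λ)`-optimal modular parametrisation of `A_g`. Then
> `[A_g(L) ⊗_𝒪 𝒪_λ : 𝒪_λ·P_L]² ≥ |#Ш(A_{g/L})[λ^∞] · ∏_{q∣N} c_q(A_g)²|_λ^{-1}`.
> **Remark 11.9.** The `p`-part of the conjectural BSD formula for `A_g` over `L` predicts the upper
> bound as in Theorem 11.8(b) to be an equality. The above upper bound is finer than the one
> arising from the Kolyvagin system of Heegner points. Specifically, `p` is allowed to divide the
> Tamagawa numbers, unlike the results of [Kolyvagin], [Howard]. (p. 93)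

with (van_M) "`T̄^{G_M} = 0`" and (im) "there exists `σ ∈ G_ℚ` fixing `ℚ_∞` such that `T/(σ−1)`
is a free `𝒪_λ`-module of rank `1`" (Thm. 9.21 (b), p. 84). Part (a) and Cor. 11.10 (first
sentence: `ord_{s=1} L(s,E) = 1 ⟹ rank 1, #Ш(E)[p^∞] < ∞`) are, for an elliptic curve, covered by
the tree's PUBLISHED Gross–Zagier–Kolyvagin fact `rank_eq_analyticRank_of_analyticRank_le_one`
and are NOT re-typed as claims.

## Transcription (elliptic-curve instance `A_g = E`, `F = ℚ`, `𝒪 = ℤ`, `λ = p`; dictionary of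
## `Jetchev2008/HeegnerIndexTamagawaBound.lean` and `HeegnerPoints.lean`)

`W` a globally minimal model of `E` (`N = W.conductorNorm ℤ`); `p ≠ 2`, good at `p`,
`p ∤ a_p ∨ a_p = 0` (`W.frobeniusTrace p`); `ord_{s=1} L(s,E) ≤ 1` = `W.analyticRank ≤ 1`;
(im) = `Rank1Residual.BigIm W p` (verbatim the tree's transcription of the same printed hypothesis
of Burungale–Castella–Skinner 2025); (van_ℚ) ∧ (irr_L) ⟸ `Rank1Residual.Surj W p` (`ρ̄_{E,p}` onto
`GL₂(𝔽_p)`: then `E(ℚ)[p] = 0`, and `ρ̄(G_L) ⊇ SL₂(𝔽_p)` acts absolutely irreducibly, `p` odd) —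
a SUFFICIENT condition, so the binder is WEAKER than print on this line (the literal (irr_L),
absolute irreducibility of `E[p]|_{G_L}`, has no elliptic-curve predicate in the tree; the
`ModPGaloisRep.IsAbsIrreducibleOverSqrt` road of `BCDTModularity.lean` would need a framed mod-`p`
representation datum — TODO(general form)); `L = K` an imaginary quadratic field
(`IsImaginaryQuadratic K`) with `p` split (`#primesOver p = 2`), `(d_K, N) = 1` (`IsCoprime`),
the Heegner hypothesis (`SatisfiesHeegnerHypothesis N K`), and `ord_{s=1} L(s, E/K) = 1` =
`LDerivEK W K ≠ 0` (under (Heeg) the sign is `−1`, so `L(E/K,1) = 0`); `P_L` = a Heegner point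
`P ∈ E(K)` (`IsHeegnerPoint N W K P`) of an OPTIMAL `E` — optimality as the strong-Weil datum
`hopt` of the Jetchev fact ("`c·Λ_f = Λ_E` for some parametrisation datum"; an `X₀(N)`-optimal curve
is `(ℤ,p)`-optimal for every `p`, so again WEAKER than print) — of infinite order (`¬ IsOfFinAddOrder P`;
automatic in print by Gross–Zagier, kept as a binder). Conclusion, with
`[E(L) ⊗ ℤ_p : ℤ_p·P_L] = p^{ord_p [E(L) : ℤ P_L]}` (`E(L)` of rank one, `P_L` non-torsion) and
`∏_{q∣N} c_q(E) = W.tamagawaProduct`: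
`ord_p #Ш(E/K)[p^∞] + 2·ord_p ∏_q c_q(E) ≤ 2·ord_p [E(K) : ℤ P]`, spelled with
`Nat.card (AddCommGroup.primaryComponent (W.baseChange K).sha p)` and `(AddSubgroup.zmultiples P).index`
exactly as in the Jetchev fact (whose bound has `2·ord_p c_q` for ONE `q ∣ N` where this one has the
full product — Rem. 11.9).

## What the theorems do (per pair; nothing booked; the OPEN binder is an explicit hypothesis)

* `padicValNat_card_shaPrimary_baseChange_eq_zero_of_thm118b_OPEN_of_index_le` — granted the binder,
  the certificate `ord_p [E(K) : ℤ P] ≤ ord_p ∏_q c_q(E)` (the BSD-predicted EQUALITY when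
  `Ш(E/K)[p] = 0`, Rem. 11.9; it is the shape the `Ш`-census lane measures at pairs where `p` divides
  SEVERAL Tamagawa numbers or one of them twice, where Jetchev's one-`q` certificate is empty) gives
  `ord_p #Ш(E/K)[p^∞] = 0`;
* `noPTorsion_of_thm118b_OPEN_of_index_le` — hence `Ш(E/ℚ)[p] = 0` (Kolyvagin's finiteness
  `kolyvagin N W K` by name + `injOn_shaRestriction_torsionBy`, verbatim the Jetchev chain);
* `bsdp_of_thm118b_OPEN_of_index_le` — with GZK and `ord_p #Ш_an = 0`, Miller's `BSD(E,p)`.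

## References
* [BurungaleSkinnerTianWan2024] arXiv:2409.01350v2: Thm. 11.8, Rem. 11.9, Cor. 11.10 (pp. 92–93;
  labels boundSha, tex l.7847 / l.7941 / l.7950); hypotheses (ord) = (2.15), (coprime) = (9.9),
  (Heeg), (irr_K)/(van_M) (§2.2.2, tex l.1264–1270), (im) (Thm. 9.21 (b), p. 84).
* [Jetchev2008] Compos. Math. 144 (2008) Cor. 1.5 — the PUBLISHED one-prime bound (tree fact
  `Jetchev2008.cor15_padicValNat_card_primaryComponent_sha_le`), whose certificate chain this file copies.
* [GrossLMS1991] Thm. 1.3 (Kolyvagin); [Miller2011LMS] Def. 1.1.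
-/

noncomputable section

open scoped Classical

open WeierstrassCurve Literature.NumberTheory.EllipticCurves
  Literature.NumberTheory.EllipticCurves.ModularForms
  Literature.NumberTheory.EllipticCurves.Rank1Residual
  Literature.NumberTheory.EllipticCurves.Rank1Residual.Typed NumberField

namespace Literature.NumberTheory.EllipticCurves.BurungaleSkinnerTianWan2024

/-- **OPEN HYPOTHESIS — UNREFEREED PREPRINT (arXiv:2409.01350v2), Thm. 11.8 (b) (p. 92), for an
elliptic curve** (`A_g = E`, `F = ℚ`, `λ = p`). "Let `p ∤ 2N` … either `p ∤ a_p` or `a_p = 0`.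
(b) Suppose that `ord_{s=1} L(s,E) ≤ 1`. Suppose also that (van_ℚ) and (im) hold. Let `L` be an
imaginary quadratic field satisfying (ord), (coprime), (Heeg) and (irr_L) so that
`ord_{s=1} L(s,E/L) = 1`. Let `P_L ∈ E(L)` be the Heegner point arising from a `(ℤ,p)`-optimal
modular parametrisation of `E`. Then `[E(L) ⊗ ℤ_p : ℤ_p·P_L]² ≥ |#Ш(E/L)[p^∞]·∏_{q∣N} c_q(E)²|_p^{-1}`."
Transcribed (module docstring): `W` globally minimal, `N = W.conductorNorm ℤ`; `p ≠ 2`, good at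
`p`, `p ∤ a_p ∨ a_p = 0`; `W.analyticRank ≤ 1`; (im) = `BigIm W p`; (van_ℚ) ∧ (irr_L) ⟸ `Surj W p`
(sufficient condition — WEAKER than print); `K` imaginary quadratic, `p` split in `K`,
`(d_K, N) = 1`, Heegner hypothesis, `L'(E/K,1) ≠ 0`; `P` a Heegner point of an `X₀(N)`-optimal `W`
(`hopt`, the Jetchev fact's optimality datum — WEAKER than print) of infinite order; conclusion
`ord_p #Ш(E/K)[p^∞] + 2·ord_p ∏_q c_q(E) ≤ 2·ord_p [E(K) : ℤ P]`. NEVER cite this `Prop` as a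
theorem; take it as an explicit hypothesis. [claim: BurungaleSkinnerTianWan2024, status: under-review]
[cite: BurungaleSkinnerTianWan2024, Thm. 11.8 (b) with Rem. 11.9 (pp. 92–93; label boundSha, tex l.7847; ANNOUNCED, OPEN binder)] -/
def thm118b_heegnerIndex_shaBound_OPEN : Prop :=
  ∀ (W : WeierstrassCurve ℚ) [W.IsElliptic] [W.IsGloballyMinimal] [NeZero (W.conductorNorm ℤ)]
    (p : ℕ) [Fact p.Prime] (K : Type) [Field K] [NumberField K],
    -- `p ∤ 2N`, ordinary (`p ∤ a_p`) or `a_p = 0`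
    p ≠ 2 → W.HasGoodReductionAtPrime p →
    (¬ (p : ℤ) ∣ W.frobeniusTrace p ∨ W.frobeniusTrace p = 0) →
    -- `ord_{s=1} L(s, E) ≤ 1`
    W.analyticRank ≤ 1 →
    -- (im); (van_ℚ) ∧ (irr_L) via surjectivity of `ρ̄_{E,p}`
    BigIm W p → Surj W p →
    -- `L = K`: imaginary quadratic, (ord), (coprime), (Heeg), `ord_{s=1} L(s, E/K) = 1`
    IsImaginaryQuadratic K →
    ((Ideal.span {(p : ℤ)}).primesOver (𝓞 K)).ncard = 2 →
    IsCoprime (NumberField.discr K) (W.conductorNorm ℤ) →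
    SatisfiesHeegnerHypothesis (W.conductorNorm ℤ) K →
    LDerivEK W K ≠ 0 →
    -- optimality of `E` (strong Weil datum) and the Heegner point `P_L` of infinite order
    (∃ Dt : ModularParametrizationData W (W.conductorNorm ℤ),
      ∀ z ∈ Dt.L.lattice, ∃ w ∈ periodLattice Dt.f, z = (Dt.c : ℂ) * w) →
    ∀ {P : (W.baseChange K).toAffine.Point}, IsHeegnerPoint (W.conductorNorm ℤ) W K P →
      ¬ IsOfFinAddOrder P →
    padicValNat p (Nat.card (AddCommGroup.primaryComponent (W.baseChange K).sha p)) +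
        2 * padicValNat p W.tamagawaProduct ≤
      2 * padicValNat p (AddSubgroup.zmultiples P).index

variable (W : WeierstrassCurve ℚ) [W.IsElliptic] [W.IsGloballyMinimal] [NeZero (W.conductorNorm ℤ)]
  (p : ℕ) [Fact p.Prime] {K : Type} [Field K] [NumberField K]

/-- **The index certificate with the FULL Tamagawa product kills `Ш(E/K)[p^∞]` — CONDITIONAL on the
OPEN binder.** Granted `hBSTW_OPEN` (unrefereed Thm. 11.8 (b)), at a datum as in the binder the
certificate `ord_p [E(K) : ℤ P] ≤ ord_p ∏_q c_q(E)` (Rem. 11.9: the BSD-predicted equality when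
`Ш(E/K)[p] = 0`) gives `ord_p #Ш(E/K)[p^∞] = 0` (arithmetic). Per pair; closes nothing.
[claim: BurungaleSkinnerTianWan2024, status: under-review]
[cite: BurungaleSkinnerTianWan2024, Thm. 11.8 (b) and Rem. 11.9 (pp. 92–93; OPEN binder)] -/
theorem padicValNat_card_shaPrimary_baseChange_eq_zero_of_thm118b_OPEN_of_index_le
    (hBSTW_OPEN : thm118b_heegnerIndex_shaBound_OPEN)
    (hp2 : p ≠ 2) (hgood : W.HasGoodReductionAtPrime p)
    (hap : ¬ (p : ℤ) ∣ W.frobeniusTrace p ∨ W.frobeniusTrace p = 0) (hr : W.analyticRank ≤ 1)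
    (him : BigIm W p) (hsurj : Surj W p) (hK : IsImaginaryQuadratic K)
    (hsplit : ((Ideal.span {(p : ℤ)}).primesOver (𝓞 K)).ncard = 2)
    (hcop : IsCoprime (NumberField.discr K) (W.conductorNorm ℤ))
    (hH : SatisfiesHeegnerHypothesis (W.conductorNorm ℤ) K) (hL : LDerivEK W K ≠ 0)
    (hopt : ∃ Dt : ModularParametrizationData W (W.conductorNorm ℤ),
      ∀ z ∈ Dt.L.lattice, ∃ w ∈ periodLattice Dt.f, z = (Dt.c : ℂ) * w)
    {P : (W.baseChange K).toAffine.Point} (hP : IsHeegnerPoint (W.conductorNorm ℤ) W K P)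
    (hnt : ¬ IsOfFinAddOrder P)
    (hle : padicValNat p (AddSubgroup.zmultiples P).index ≤ padicValNat p W.tamagawaProduct) :
    padicValNat p (Nat.card (AddCommGroup.primaryComponent (W.baseChange K).sha p)) = 0 := by
  have hb := hBSTW_OPEN W p K hp2 hgood hap hr him hsurj hK hsplit hcop hH hL hopt hP hnt
  omega

/-- **Hence `Ш(E/ℚ)[p] = 0` — CONDITIONAL on the OPEN binder.** Same data; in addition the PUBLISHED
named fact `hKo` (`kolyvagin N W K`: a Heegner point of infinite order ⇒ `Ш(E/K)` finite). Then
`p ∤ #Ш(E/K)`, no element of `Ш(E/K)` has order `p`, and restriction `Ш(E/ℚ) → Ш(E/K)` is injective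
on `Ш(E/ℚ)[p]` for `p` prime to `[K:ℚ] = 2` (`injOn_shaRestriction_torsionBy`) — verbatim the argument
of `Typed.noPTorsion_of_jetchev_of_index_le_tamagawa` with BSTW's bound in place of Jetchev's. Per
pair; closes nothing. [claim: BurungaleSkinnerTianWan2024, status: under-review]
[cite: GrossLMS1991, §1 Thm. 1.3 (2), p. 236] [cite: SerreGaloisCohomology1997, I.§2.4 Cor. to Prop. 9] -/
theorem noPTorsion_of_thm118b_OPEN_of_index_le
    (hBSTW_OPEN : thm118b_heegnerIndex_shaBound_OPEN)
    (hKo : kolyvagin (W.conductorNorm ℤ) W K)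
    (hp2 : p ≠ 2) (hgood : W.HasGoodReductionAtPrime p)
    (hap : ¬ (p : ℤ) ∣ W.frobeniusTrace p ∨ W.frobeniusTrace p = 0) (hr : W.analyticRank ≤ 1)
    (him : BigIm W p) (hsurj : Surj W p) (hK : IsImaginaryQuadratic K)
    (hsplit : ((Ideal.span {(p : ℤ)}).primesOver (𝓞 K)).ncard = 2)
    (hcop : IsCoprime (NumberField.discr K) (W.conductorNorm ℤ))
    (hH : SatisfiesHeegnerHypothesis (W.conductorNorm ℤ) K) (hL : LDerivEK W K ≠ 0)
    (hopt : ∃ Dt : ModularParametrizationData W (W.conductorNorm ℤ),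
      ∀ z ∈ Dt.L.lattice, ∃ w ∈ periodLattice Dt.f, z = (Dt.c : ℂ) * w)
    {P : (W.baseChange K).toAffine.Point} (hP : IsHeegnerPoint (W.conductorNorm ℤ) W K P)
    (hnt : ¬ IsOfFinAddOrder P)
    (hle : padicValNat p (AddSubgroup.zmultiples P).index ≤ padicValNat p W.tamagawaProduct) :
    ∀ x : W.sha, (p : ℤ) • x = 0 → x = 0 := by
  have hp : p.Prime := Fact.out
  obtain ⟨-, hfinK⟩ := hKo hK hH hP hnt
  haveI : Finite (W.baseChange K).sha := hfinK
  have h0 : padicValNat p (Nat.card (W.baseChange K).sha) = 0 := by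
    rw [← padicValNat_card_addPrimaryComponent (A := (W.baseChange K).sha) p]
    exact padicValNat_card_shaPrimary_baseChange_eq_zero_of_thm118b_OPEN_of_index_le W p hBSTW_OPEN
      hp2 hgood hap hr him hsurj hK hsplit hcop hH hL hopt hP hnt hle
  have hndvd : ¬ p ∣ Nat.card (W.baseChange K).sha := by
    rcases padicValNat.eq_zero_iff.mp h0 with h1 | h0' | hnd
    · exact absurd h1 hp.one_lt.ne'
    · exact absurd h0' Nat.card_pos.ne'
    · exact hnd
  haveI : IsGalois ℚ K := by
    haveI : Algebra.IsQuadraticExtension ℚ K := ⟨hK.1⟩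
    infer_instance
  have hcopr : p.Coprime (Module.finrank ℚ K) := by
    rw [hK.1]
    exact (Nat.coprime_primes hp Nat.prime_two).mpr hp2
  intro x hx
  have hxn : p • x = 0 := by rw [← natCast_zsmul]; exact hx
  -- the restriction of `x` is killed by `p` in a finite group of order prime to `p`, hence is `0`
  have hres : shaRestriction W K x = 0 := by
    have hpr : p • shaRestriction W K x = 0 := by rw [← map_nsmul, hxn, map_zero]
    have hdiv : addOrderOf (shaRestriction W K x) ∣ p := addOrderOf_dvd_of_nsmul_eq_zero hpr
    rcases (Nat.dvd_prime hp).mp hdiv with h1 | hp'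
    · exact AddMonoid.addOrderOf_eq_one_iff.mp h1
    · exact absurd (hp' ▸ addOrderOf_dvd_natCard (shaRestriction W K x)) hndvd
  -- injectivity of restriction on `Ш(E/ℚ)[p]`
  have hx_mem : x ∈ (AddSubgroup.torsionBy W.sha p : Set W.sha) :=
    AddSubgroup.torsionBy.nsmul_iff.mpr hxn
  have h0_mem : (0 : W.sha) ∈ (AddSubgroup.torsionBy W.sha p : Set W.sha) :=
    AddSubgroup.torsionBy.nsmul_iff.mpr (smul_zero _)
  exact injOn_shaRestriction_torsionBy W K hcopr hx_mem h0_mem (by rw [hres, map_zero])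

/-- **`BSD(E,p)` from the full-Tamagawa index certificate at a pair with `ord_p #Ш_an = 0` —
CONDITIONAL on the OPEN binder** (analytic rank `≤ 1`; PUBLISHED facts `hKo` Kolyvagin and `hGZK`
Gross–Zagier–Kolyvagin by name; `Typed.bsdp_of_shaAn_unit_of_noPTorsion`). The companion of
`Typed.bsdp_of_jetchev_of_index_le_tamagawa` for pairs where `p` divides several Tamagawa numbers
(Rem. 11.9). Per pair; closes nothing; the binder is PRE.
[claim: BurungaleSkinnerTianWan2024, status: under-review] [cite: Miller2011LMS, §1 and Def. 1.1] -/
theorem bsdp_of_thm118b_OPEN_of_index_le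
    (hBSTW_OPEN : thm118b_heegnerIndex_shaBound_OPEN)
    (hGZK : rank_eq_analyticRank_of_analyticRank_le_one)
    (hKo : kolyvagin (W.conductorNorm ℤ) W K)
    (hp2 : p ≠ 2) (hgood : W.HasGoodReductionAtPrime p)
    (hap : ¬ (p : ℤ) ∣ W.frobeniusTrace p ∨ W.frobeniusTrace p = 0) (hr : W.analyticRank ≤ 1)
    (him : BigIm W p) (hsurj : Surj W p) (hK : IsImaginaryQuadratic K)
    (hsplit : ((Ideal.span {(p : ℤ)}).primesOver (𝓞 K)).ncard = 2)
    (hcop : IsCoprime (NumberField.discr K) (W.conductorNorm ℤ))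
    (hH : SatisfiesHeegnerHypothesis (W.conductorNorm ℤ) K) (hL : LDerivEK W K ≠ 0)
    (hopt : ∃ Dt : ModularParametrizationData W (W.conductorNorm ℤ),
      ∀ z ∈ Dt.L.lattice, ∃ w ∈ periodLattice Dt.f, z = (Dt.c : ℂ) * w)
    {P : (W.baseChange K).toAffine.Point} (hP : IsHeegnerPoint (W.conductorNorm ℤ) W K P)
    (hnt : ¬ IsOfFinAddOrder P)
    (hle : padicValNat p (AddSubgroup.zmultiples P).index ≤ padicValNat p W.tamagawaProduct)
    {s : ℚ} (hs : shaAn W = (s : ℂ)) (hv : padicValRat p s = 0) :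
    BSDp W p :=
  bsdp_of_shaAn_unit_of_noPTorsion W p hGZK hr hs hv
    (noPTorsion_of_thm118b_OPEN_of_index_le W p hBSTW_OPEN hKo hp2 hgood hap hr him hsurj hK hsplit
      hcop hH hL hopt hP hnt hle)

end Literature.NumberTheory.EllipticCurves.BurungaleSkinnerTianWan2024

end
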